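import Summits.KontsevichZagierPeriods.KontsevichZagierPeriods.Theorems.CompleteModGammaSector.Negative.Admissible
import Summits.KontsevichZagierPeriods.KontsevichZagierPeriods.Theorems.CompleteModGammaSector.Negative.EulerGlue
import Literature.ModelTheory.ExponentialFields.OMinimalEulerInvariance

/-!
# `CompleteModGammaSector` — negative side IV: DOMAIN ADDITIVITY is load-bearing, even modulo every Γ-Hodge pair (modulo van den Dries Ch. 4 (2.4))

Landed copy of §§6C–6D of `Cruxes/CompleteModGammaSector/Disproof.lean` (cdisprove, gen 1). The
Euler-parity-weighted evaluation `ψ [σ, f] = ∫_σ f` if `E(σ)` is even, `0` if odd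
(`evenEulerEval`) is preserved by rule (1b) (same domain), rule (3) (`E(band) = E(base)`,
unconditional), rule (2) MODULO the tree's named fact `Dries1998_ch4_prop_2_4` (taken as a
hypothesis `hE`), and by every Γ-Hodge pair UNCONDITIONALLY (both domains have odd `E`:
`pairHyp_ker_evenEulerEval`). The rational pair `∫_{[0,1]∪[2,3]} 1 = ∫_{[0,2]} 1` (`E = 2` vs
`1`; a true instance: split, translate, merge — `euler_witness_mem_relations`) has `ψ = 2`.

* `completeModGammaSector_false_without_domainAdd hE`;
* `not_periodConjecture_rulesNoDomainAdd hE` — summit level: rules (1b), (2), (3) alone do not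
  give Conjecture 1 (modulo vdD (2.4)).
With `Negative/NewtonLeibniz.lean` and `Negative/ChangeOfVariables.lean`: each of (1a), (2), (3) is
independent of the other rules plus the Γ-sector; (1b) is derivable from (1a), (2), (3) on paper.
-/

noncomputable section

open MeasureTheory Set
open scoped BigOperators Topology

namespace Summit.KontsevichZagierPeriods.CompleteModGammaSectorNegative

open Literature.NumberTheory.Transcendental
open Literature.NumberTheory.Transcendental.KZ
open Literature.ModelTheory.ExponentialFields (IsSemialgebraic)
open Summit.KontsevichZagierPeriods.KontsevichZagierPeriods.Theses.TerasomaMultiplication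
  (CompleteModGammaSector GammaHodgeSector closes)
open Summit.KontsevichZagierPeriods.GammaHodgeSectorNegative
open Literature.Barriers.KontsevichZagierPeriods.KZ (constRep constRep_value constRep_isRational)
open FirstOrder FirstOrder.Language
open Literature.ModelTheory.ExponentialFields
open Literature.ModelTheory.ExponentialFields.CellDimension
open MvPolynomial (aeval X C)

/-! ### §6C The invariant: Euler-parity-weighted evaluation `ψ` -/

/-- **Euler-parity-weighted evaluation**: `ψ [σ, f] = ∫_σ f` if `E(σ)` is even, `0` if odd.
[folklore] -/
def evenEulerEval : FormalRep →+ ℝ :=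
  FreeAbelianGroup.lift fun p => if Even (realEuler p.1 p.2.domain) then p.2.value else 0

/-- `ψ` of a generator. [folklore] -/
theorem evenEulerEval_of {n : ℕ} (r : IntegralRep n) :
    evenEulerEval (of r) = if Even (realEuler n r.domain) then r.value else 0 :=
  FreeAbelianGroup.lift_apply_of _ _

/-- Rule (1b) preserves `ψ` (same domain; soundness of (1b)). [cite: KontsevichZagier2001, §1.2 rule (1)] -/
theorem evenEulerEval_eq_zero_of_mem_integrandAddRel {c : FormalRep} (hc : c ∈ integrandAddRel) :
    evenEulerEval c = 0 := by
  have he : eval c = 0 := eval_eq_zero_of_mem_integrandAddRel_holds hc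
  obtain ⟨n, r, r₁, r₂, h₁, h₂, -, rfl⟩ := hc
  simp only [map_sub, eval_of] at he
  simp only [map_sub, evenEulerEval_of, h₁, h₂]
  split_ifs <;> linarith

/-- Rule (3) preserves `ψ` (`E(band) = E(base)`; soundness of (3)). [cite: KontsevichZagier2001, §1.2 rule (3)] -/
theorem evenEulerEval_eq_zero_of_mem_newtonLeibnizRel {c : FormalRep} (hc : c ∈ newtonLeibnizRel) :
    evenEulerEval c = 0 := by
  have he : eval c = 0 := eval_eq_zero_of_mem_newtonLeibnizRel_holds hc
  obtain ⟨n, r, r', a, b, F, -, -, -, hab, hdom, -, -, -, rfl⟩ := hc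
  simp only [map_sub, eval_of] at he
  simp only [map_sub, evenEulerEval_of, realEuler_band r r' hab hdom]
  split_ifs <;> linarith

/-- Rule (2) preserves `ψ` MODULO van den Dries Ch. 4 (2.4) (`E(Φ σ) = E(σ)` for an injective
semialgebraic `Φ`; soundness of (2)). [cite: Dries1998, Ch. 4 (2.4)] -/
theorem evenEulerEval_eq_zero_of_mem_changeOfVariablesRel
    (hE : Dries1998_ch4_prop_2_4 Language.orderedRing ℝ) {c : FormalRep}
    (hc : c ∈ changeOfVariablesRel) : evenEulerEval c = 0 := by
  have he : eval c = 0 := eval_eq_zero_of_mem_changeOfVariablesRel_holds hc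
  obtain ⟨n, r, r', Φ, Φ', h1, -, h3, h4, -, rfl⟩ := hc
  simp only [map_sub, eval_of] at he
  have hEq : realEuler n r'.domain = realEuler n r.domain := by
    rw [realEuler, realEuler, h4]
    exact hE isOMinimal_real definable_lt_real r.domain Φ (definable_univ_of_isSemialgebraic h1) h3
  simp only [map_sub, evenEulerEval_of, hEq]
  split_ifs <;> linarith

/-- **Every Γ-Hodge pair preserves `ψ` UNCONDITIONALLY**: both domains have odd Euler
characteristic (`(−1)^N` and `(−1)^{2k}(−1)^{N'}`), so `ψ` vanishes on each representation
separately. [folklore] -/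
theorem evenEulerEval_pair {N N' k : ℕ} (ρ : IntegralRep N) (ρ' : IntegralRep (2 * k + N'))
    (hd : ρ.domain = {t | ∀ j, t j ∈ Set.Ioo (0:ℝ) 1})
    (hd' : ρ'.domain = {z | (∑ i : Fin (2 * k), (z (Fin.castAdd N' i)) ^ 2) < 1 ∧
      ∀ l : Fin N', z (Fin.natAdd (2 * k) l) ∈ Set.Ioo (0:ℝ) 1}) :
    evenEulerEval (of ρ - of ρ') = 0 := by
  have h1 : ¬ Even (realEuler N ρ.domain) := by
    rw [hd, Int.not_even_iff_odd]
    exact odd_realEuler_cube N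
  have h2 : ¬ Even (realEuler (2 * k + N') ρ'.domain) := by
    rw [hd', Int.not_even_iff_odd]
    exact odd_realEuler_ballCube k N'
  rw [map_sub, evenEulerEval_of, evenEulerEval_of, if_neg h1, if_neg h2, sub_self]

/-- The subgroup generated by rules (1b), (2), (3) — everything except DOMAIN additivity. -/
def rulesNoDomainAdd : AddSubgroup FormalRep :=
  AddSubgroup.closure (integrandAddRel ∪ changeOfVariablesRel ∪ newtonLeibnizRel)

/-- `rulesNoDomainAdd ≤ relations`. [folklore] -/
theorem rulesNoDomainAdd_le_relations : rulesNoDomainAdd ≤ relations := by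
  unfold rulesNoDomainAdd relations
  refine AddSubgroup.closure_mono ?_
  rintro c ((hc | hc) | hc)
  · exact Or.inl (Or.inl (Or.inr hc))
  · exact Or.inl (Or.inr hc)
  · exact Or.inr hc

/-- Rules (1b), (2), (3) preserve `ψ` (modulo (2.4) for rule (2)). [folklore] -/
theorem rulesNoDomainAdd_le_ker (hE : Dries1998_ch4_prop_2_4 Language.orderedRing ℝ) :
    rulesNoDomainAdd ≤ evenEulerEval.ker := by
  refine (AddSubgroup.closure_le _).mpr ?_
  rintro c ((hc | hc) | hc)
  · exact evenEulerEval_eq_zero_of_mem_integrandAddRel hc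
  · exact evenEulerEval_eq_zero_of_mem_changeOfVariablesRel hE hc
  · exact evenEulerEval_eq_zero_of_mem_newtonLeibnizRel hc

/-! ### §6D The witness: `∫_{[0,1]∪[2,3]} 1 = ∫_{[0,2]} 1` -/

/-- The band `{a ≤ x₀ ≤ b} ⊆ ℝ¹` with rational ends. -/
def qband (a b : ℚ) : Set (Fin 1 → ℝ) := {x | (a : ℝ) ≤ x 0 ∧ x 0 ≤ b}

/-- Bands are `ℚ`-semialgebraic. [folklore] -/
theorem isSemialgebraic_qband (a b : ℚ) : IsSemialgebraic ℚ (qband a b) := by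
  have h : qband a b =
      {x : Fin 1 → ℝ | aeval x (C a : MvPolynomial (Fin 1) ℚ) ≤ aeval x (X 0 : MvPolynomial (Fin 1) ℚ)} ∩
        {x | aeval x (X 0 : MvPolynomial (Fin 1) ℚ) ≤ aeval x (C b : MvPolynomial (Fin 1) ℚ)} := by
    ext x
    simp [qband]
  rw [h]
  exact (Literature.ModelTheory.ExponentialFields.isSemialgebraic_setOf_eval_le _ _).inter
    (Literature.ModelTheory.ExponentialFields.isSemialgebraic_setOf_eval_le _ _)

/-- Bands are compact. [folklore] -/
theorem isCompact_qband (a b : ℚ) : IsCompact (qband a b) := by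
  convert isCompact_univ_pi (fun _ : Fin 1 => (isCompact_Icc : IsCompact (Icc (a : ℝ) b))) using 1
  ext x
  simp [qband, Set.pi, Fin.forall_fin_one]

/-- The constant-`1` representation over a compact `ℚ`-semialgebraic domain of `ℝ¹`. -/
def constOneRep (σ : Set (Fin 1 → ℝ)) (hσ : IsSemialgebraic ℚ σ) (hc : IsCompact σ) : IntegralRep 1 where
  domain := σ
  integrand := fun _ => 1
  isSemialgebraic_domain := hσ
  isSemialgebraicFunOn_integrand := (isSemialgebraicFunOn_aeval hσ (1 : MvPolynomial (Fin 1) ℚ)).congr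
    fun x _ => by simp
  integrableOn := continuousOn_const.integrableOn_compact hc

/-- `constOneRep` has KZ's literal shape (`p = q = 1`). [folklore] -/
theorem constOneRep_isRational (σ : Set (Fin 1 → ℝ)) (hσ : IsSemialgebraic ℚ σ) (hc : IsCompact σ) :
    (constOneRep σ hσ hc).IsRational :=
  ⟨1, 1, fun _ _ => by simp, fun x _ => by simp [constOneRep]⟩

/-- `r₁ = [[0,1] ∪ [2,3], 1]` (value `2`, Euler characteristic `2`). -/
def twoIntervalsRep : IntegralRep 1 :=
  constOneRep (qband 0 1 ∪ qband 2 3) ((isSemialgebraic_qband 0 1).union (isSemialgebraic_qband 2 3))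
    ((isCompact_qband 0 1).union (isCompact_qband 2 3))

/-- `r₁' = [[0,2], 1]` (value `2`, Euler characteristic `1`). -/
def oneIntervalRep : IntegralRep 1 := constOneRep (qband 0 2) (isSemialgebraic_qband 0 2) (isCompact_qband 0 2)

/-- `[[0,1], 1]`. -/
def band01Rep : IntegralRep 1 := constOneRep (qband 0 1) (isSemialgebraic_qband 0 1) (isCompact_qband 0 1)
/-- `[[2,3], 1]`. -/
def band23Rep : IntegralRep 1 := constOneRep (qband 2 3) (isSemialgebraic_qband 2 3) (isCompact_qband 2 3)
/-- `[[1,2], 1]`. -/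
def band12Rep : IntegralRep 1 := constOneRep (qband 1 2) (isSemialgebraic_qband 1 2) (isCompact_qband 1 2)

/-- Split `[0,1] ∪ [2,3]` (disjoint pieces): one move of rule (1a). [cite: KontsevichZagier2001, §1.2 rule (1)] -/
theorem split_mem_domainAddRel : of twoIntervalsRep - of band01Rep - of band23Rep ∈ domainAddRel := by
  refine ⟨1, twoIntervalsRep, band01Rep, band23Rep, rfl, ?_, fun _ _ => rfl, fun _ _ => rfl, rfl⟩
  have h : (band01Rep.domain ∩ band23Rep.domain : Set (Fin 1 → ℝ)) = ∅ := by
    ext x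
    simp only [mem_inter_iff, mem_empty_iff_false, iff_false, not_and]
    intro h1 h2
    have := h1.2
    have := h2.1
    simp only [band01Rep, band23Rep, constOneRep, qband, Rat.cast_one, Rat.cast_ofNat] at *
    linarith
  rw [h, measure_empty]

/-- Merge `[0,1] ∪ [1,2] = [0,2]` (overlap `{1}` is null): one move of rule (1a). [cite: KontsevichZagier2001, §1.2 rule (1)] -/
theorem merge_mem_domainAddRel : of oneIntervalRep - of band01Rep - of band12Rep ∈ domainAddRel := by
  refine ⟨1, oneIntervalRep, band01Rep, band12Rep, ?_, ?_, fun _ _ => rfl, fun _ _ => rfl, rfl⟩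
  · show qband 0 2 = qband 0 1 ∪ qband 1 2
    ext x
    simp only [qband, mem_union, mem_setOf_eq, Rat.cast_zero, Rat.cast_one, Rat.cast_ofNat]
    constructor
    · intro h
      rcases le_total (x 0) 1 with h1 | h1
      · exact Or.inl ⟨h.1, h1⟩
      · exact Or.inr ⟨h1, h.2⟩
    · rintro (h | h) <;> constructor <;> linarith [h.1, h.2]
  · have hsub : (band01Rep.domain ∩ band12Rep.domain : Set (Fin 1 → ℝ)) ⊆
        (MeasurableEquiv.funUnique (Fin 1) ℝ) ⁻¹' {(1 : ℝ)} := by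
      intro x hx
      have h1 : x 0 ≤ 1 := by simpa [band01Rep, constOneRep, qband] using hx.1.2
      have h2 : (1 : ℝ) ≤ x 0 := by simpa [band12Rep, constOneRep, qband] using hx.2.1
      show x 0 ∈ ({(1 : ℝ)} : Set ℝ)
      exact mem_singleton_iff.mpr (le_antisymm h1 h2)
    refine measure_mono_null hsub ?_
    have h : volume ((MeasurableEquiv.funUnique (Fin 1) ℝ) ⁻¹' {(1 : ℝ)}) = volume ({(1 : ℝ)} : Set ℝ) :=
      (volume_preserving_funUnique (Fin 1) ℝ).measure_preimage_equiv _
    rw [h]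
    exact Real.volume_singleton

/-- Translate `[2,3] → [1,2]`: one move of rule (2). [cite: KontsevichZagier2001, §1.2 rule (2)] -/
theorem translate_mem_changeOfVariablesRel : of band23Rep - of band12Rep ∈ changeOfVariablesRel := by
  refine ⟨1, band23Rep, band12Rep, fun x => x + fun _ => (-1 : ℝ), fun _ => ContinuousLinearMap.id ℝ (Fin 1 → ℝ),
    ?_, ?_, ?_, ?_, ?_, rfl⟩
  · refine (isSemialgebraicMapOn_aeval band23Rep.isSemialgebraic_domain
      (fun _ => (X 0 + C (-1) : MvPolynomial (Fin 1) ℚ))).congr ?_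
    intro x _
    funext j
    rw [Subsingleton.elim j 0]
    simp
  · intro x _
    exact (hasFDerivWithinAt_id x _).add_const _
  · intro x _ y _ h
    exact add_right_cancel h
  · show qband 1 2 = (fun x => x + fun _ => (-1 : ℝ)) '' qband 2 3
    ext y
    simp only [qband, mem_setOf_eq, mem_image, Rat.cast_one, Rat.cast_ofNat]
    constructor
    · rintro ⟨h1, h2⟩
      refine ⟨y - fun _ => (-1 : ℝ), ⟨?_, ?_⟩, ?_⟩
      · simp only [Pi.sub_apply]
        linarith
      · simp only [Pi.sub_apply]
        linarith
      · simp
    · rintro ⟨x, ⟨h1, h2⟩, rfl⟩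
      simp only [Pi.add_apply]
      constructor <;> linarith
  · intro x _
    simp [band23Rep, band12Rep, constOneRep, ContinuousLinearMap.det]

/-- **The witness pair is a TRUE instance**: `[r₁] − [r₁'] ∈ relations` (two moves of rule (1a)
and one translation). [folklore] -/
theorem euler_witness_mem_relations : of twoIntervalsRep - of oneIntervalRep ∈ relations := by
  have h1 : of twoIntervalsRep - of band01Rep - of band23Rep ∈ relations :=
    domainAddRel_subset_relations split_mem_domainAddRel
  have h2 : of oneIntervalRep - of band01Rep - of band12Rep ∈ relations :=
    domainAddRel_subset_relations merge_mem_domainAddRel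
  have h3 : of band23Rep - of band12Rep ∈ relations :=
    changeOfVariablesRel_subset_relations translate_mem_changeOfVariablesRel
  have heq : of twoIntervalsRep - of oneIntervalRep =
      (of twoIntervalsRep - of band01Rep - of band23Rep) + (of band23Rep - of band12Rep) -
        (of oneIntervalRep - of band01Rep - of band12Rep) := by abel
  rw [heq]
  exact relations.sub_mem (relations.add_mem h1 h3) h2

/-- Hence equal values. [folklore] -/
theorem euler_witness_value_eq : twoIntervalsRep.value = oneIntervalRep.value := by
  have h := relations_le_ker_eval_holds euler_witness_mem_relations
  rwa [AddMonoidHom.mem_ker, eval_of_sub_of, sub_eq_zero] at h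

/-- `value [[0,2], 1] = 2`. [folklore] -/
theorem oneIntervalRep_value : oneIntervalRep.value = 2 := by
  show ∫ x in qband 0 2, (fun _ : Fin 1 → ℝ => (1 : ℝ)) x = 2
  rw [setIntegral_const]
  have hset : qband 0 2 = (MeasurableEquiv.funUnique (Fin 1) ℝ) ⁻¹' Icc (0 : ℝ) 2 := by
    ext x
    simp [qband, MeasurableEquiv.funUnique, Fin.default_eq_zero]
  have h : volume ((MeasurableEquiv.funUnique (Fin 1) ℝ) ⁻¹' Icc (0 : ℝ) 2) = volume (Icc (0 : ℝ) 2) :=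
    (volume_preserving_funUnique (Fin 1) ℝ).measure_preimage_equiv _
  rw [Measure.real, hset, h, Real.volume_Icc]
  norm_num

/-- `E([0,1] ∪ [2,3]) = 2`. [cite: Dries1998, Ch. 4 (2.9)] -/
theorem realEuler_twoIntervals : realEuler 1 twoIntervalsRep.domain = 2 := by
  show realEuler 1 (qband 0 1 ∪ qband 2 3) = 2
  have hd : Disjoint (qband 0 1) (qband 2 3) := Set.disjoint_left.mpr fun x h1 h2 => by
    have := h1.2
    have := h2.1
    simp only [qband, Rat.cast_one, Rat.cast_ofNat] at *
    linarith
  rw [realEuler, eulerChar_union isOMinimal_real definable_lt_real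
    (definable_univ_of_isSemialgebraic (isSemialgebraic_qband 0 1))
    (definable_univ_of_isSemialgebraic (isSemialgebraic_qband 2 3)) hd]
  have e1 := realEuler_Icc (a := ((0 : ℚ) : ℝ)) (b := ((1 : ℚ) : ℝ)) (by norm_num)
  have e2 := realEuler_Icc (a := ((2 : ℚ) : ℝ)) (b := ((3 : ℚ) : ℝ)) (by norm_num)
  simp only [realEuler] at e1 e2
  change eulerChar Language.orderedRing 1 (qband 0 1) + eulerChar Language.orderedRing 1 (qband 2 3) = 2
  rw [show qband 0 1 = {y : Fin 1 → ℝ | ((0 : ℚ) : ℝ) ≤ y 0 ∧ y 0 ≤ ((1 : ℚ) : ℝ)} from rfl, e1,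
    show qband 2 3 = {y : Fin 1 → ℝ | ((2 : ℚ) : ℝ) ≤ y 0 ∧ y 0 ≤ ((3 : ℚ) : ℝ)} from rfl, e2]
  norm_num

/-- `E([0,2]) = 1`. [cite: Dries1998, Ch. 4 (2.9)] -/
theorem realEuler_oneInterval : realEuler 1 oneIntervalRep.domain = 1 :=
  realEuler_Icc (a := ((0 : ℚ) : ℝ)) (b := ((2 : ℚ) : ℝ)) (by norm_num)

/-- **`ψ` separates the witness**: `ψ ([r₁] − [r₁']) = 2 − 0 = 2`. [folklore] -/
theorem evenEulerEval_witness : evenEulerEval (of twoIntervalsRep - of oneIntervalRep) = 2 := by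
  have h1 : Even (realEuler 1 twoIntervalsRep.domain) := by rw [realEuler_twoIntervals]; exact even_two
  have h2 : ¬ Even (realEuler 1 oneIntervalRep.domain) := by
    rw [realEuler_oneInterval, Int.not_even_iff_odd]; exact odd_one
  rw [map_sub, evenEulerEval_of, evenEulerEval_of, if_pos h1, if_neg h2, sub_zero,
    euler_witness_value_eq, oneIntervalRep_value]

/-- **DOMAIN ADDITIVITY IS LOAD-BEARING at summit level (modulo vdD (2.4))**: rules (1b), (2), (3)
do not connect `∫_{[0,1]∪[2,3]} 1` and `∫_{[0,2]} 1`. [cite: Dries1998, Ch. 4 (2.4)] -/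
theorem witness_not_mem_rulesNoDomainAdd (hE : Dries1998_ch4_prop_2_4 Language.orderedRing ℝ) :
    of twoIntervalsRep - of oneIntervalRep ∉ rulesNoDomainAdd := by
  intro h
  have h0 := rulesNoDomainAdd_le_ker hE h
  rw [AddMonoidHom.mem_ker, evenEulerEval_witness] at h0
  norm_num at h0


/-! ### §6 assembly: rule (1a) is load-bearing modulo rules (1b), (2), (3) and every Γ-Hodge pair -/

/-- **Every Γ-Hodge pair lies in `ker ψ`** (unconditionally). [folklore] -/
theorem pairHyp_ker_evenEulerEval : PairHyp evenEulerEval.ker := by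
  intro N N' k x y x' y' c _ _ _ _ ρ ρ' hd _ hd' _ _
  exact evenEulerEval_pair ρ ρ' hd hd'

/-- The crux with `relations` SHRUNK to rules (1b), (2), (3) (DOMAIN additivity removed; the
Γ-Hodge pairs kept; negative knowledge, not a citable statement). -/
def CompleteModGammaSectorWithoutDomainAdd : Prop :=
  ∀ H : AddSubgroup FormalRep, rulesNoDomainAdd ≤ H → PairHyp H →
    ∀ ⦃n m : ℕ⦄ (r : IntegralRep n) (r' : IntegralRep m),
      r.IsRational → r'.IsRational → r.value = r'.value → of r - of r' ∈ H

/-- **DOMAIN ADDITIVITY IS LOAD-BEARING, even modulo every Γ-Hodge identity — modulo van den Dries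
Ch. 4 (2.4)** (invariance of the o-minimal Euler characteristic under injective definable maps,
tree fact `Dries1998_ch4_prop_2_4`, used only for rule (2)). `H = ker ψ` contains rules (1b), (2),
(3) and all Γ-pairs but not `∫_{[0,1]∪[2,3]} 1 − ∫_{[0,2]} 1`. With §§4–5: each of the rules (1a),
(2), (3) is independent of the other rules plus the Γ-sector; only (1b) remains (it is derivable
from (1a), (2), (3) on paper: split `σ × [0,2]`, bend each half by `t = 1 − (1−s)²`,
`t − 1 = (s−1)²`, one Newton–Leibniz move). [cite: Dries1998, Ch. 4 (2.4)] -/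
theorem completeModGammaSector_false_without_domainAdd
    (hE : Dries1998_ch4_prop_2_4 Language.orderedRing ℝ) : ¬ CompleteModGammaSectorWithoutDomainAdd := by
  intro h
  have h0 := h evenEulerEval.ker (rulesNoDomainAdd_le_ker hE) pairHyp_ker_evenEulerEval
    twoIntervalsRep oneIntervalRep (constOneRep_isRational _ _ _) (constOneRep_isRational _ _ _)
    euler_witness_value_eq
  rw [AddMonoidHom.mem_ker, evenEulerEval_witness] at h0
  norm_num at h0

/-- **Corollary at summit level (modulo vdD (2.4)): rules (1b), (2), (3) alone do not give
Conjecture 1.** [cite: KontsevichZagier2001, §1.2 Conjecture 1] -/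
theorem not_periodConjecture_rulesNoDomainAdd (hE : Dries1998_ch4_prop_2_4 Language.orderedRing ℝ) :
    ¬ ∀ ⦃n m : ℕ⦄ (r : IntegralRep n) (r' : IntegralRep m),
      r.IsRational → r'.IsRational → r.value = r'.value → of r - of r' ∈ rulesNoDomainAdd := fun h =>
  witness_not_mem_rulesNoDomainAdd hE (h twoIntervalsRep oneIntervalRep (constOneRep_isRational _ _ _)
    (constOneRep_isRational _ _ _) euler_witness_value_eq)

/-- NON-VACUITY: the Euler witness pair is a TRUE instance of the crux (`∈ relations ≤ sector`).
[folklore] -/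
theorem euler_witness_mem_sector : of twoIntervalsRep - of oneIntervalRep ∈ sector :=
  AddSubgroup.mem_sup_left euler_witness_mem_relations

end Summit.KontsevichZagierPeriods.CompleteModGammaSectorNegative
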